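import Literature.NumberTheory.EllipticCurves.YanZhu2026.GreenbergMainTheoremsAnyRoot
import HarnessLib

/-!
# Yan–Zhu 2026 (J. Algebra 693 = arXiv:2412.20078v4), proof of Thm. 4.2 (2), FIRST STEP (v4 l.1038–1041)
# — PROVED: "By Theorem 4.7 and Corollary 4.6, there exists a nontrivial multiplicative set
# `S ⊂ Λ_K⁺ ⊂ Λ_K` such that `S⁻¹Char_{Λ_K}(𝒳_{𝓕_Gr}(E/K_∞))Λ_K^ur ⊂ (𝓛_p^Gr(E/K))`"

`Proofs` companion (theorems only: no definition, no named fact, no instance) of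
`YanZhu2026/GreenbergMainTheoremsAnyRoot.lean` (seat `bsd-littype-04`, gen 4) and of the ordinary-side
file `YanZhu2026/TwoVariableMainTheorems.lean` (gen 2). It REPLAYS IN THE KERNEL the first display of
the printed proof of Theorem 4.2 (2) (arXiv v4 TeX l.1038–1041; [corpus:paper:arxiv-2412.20078 p0010],
v2 §4.3 same wording):

> "By Theorem 4.7 and Corollary 4.6, there exists a nontrivial multiplicative set `S ⊂ Λ_K⁺ ⊂ Λ_K`
> such that `S⁻¹ Char_{Λ_K}(𝒳_{𝓕_Gr}(E/K_∞)) Λ_K^{ur} ⊂ (𝓛_p^{Gr}(E/K))`."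

granted the two named facts `thm47_ord_localised_iff_greenbergAnyRoot_localised` (Thm. 4.7, the
Beilinson–Flach equivalence; cell flag `YZ26@3-BF-ERL-Ohta` at `p = 3`) and
`cor46_XOrd₂_charIdeal_le_perrinRiou_awayFromPlus` (Cor. 4.6, the ordinary-side divisibility away from
`Λ_K⁺`, flag-free: Hida theory + Skinner–Urban). HYPOTHESES of the proved statement = the union of the
two facts' binders: the Greenberg standing data `GreenbergSetting ι W N K 𝔭 𝔭̄ κ₁ κ₂` (`p > 2` good
ordinary split in `K`, `(N, D_K) = 1`, (disc), `(κ₁, κ₂)` = (cyclotomic, anticyclotomic), `𝔭` the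
`ι`-prime), `ρ̄_E|_{G_K}` IRREDUCIBLE (not absolutely; NO Heegner hypothesis, NO (Im)), an embedding
`ι₁ : ℤ̄ → ℂ_p` compatible with `ι` (the type-I frame's datum), and a Katz/Greenberg frame `(LK, G)` at
the inverse generators (`IsKatzMeasure₂ … γ₁⁻¹ γ₂⁻¹ …`, `IsGreenbergLFunctionAnyRoot₂ … γ₁⁻¹ γ₂⁻¹ …`).
CONCLUSION (one-element form of "`S ⊂ Λ_K⁺` nontrivial, `S⁻¹Char(X_Gr)Λ^ur ⊂ (𝓛^Gr)`", (T8) of the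
carrier file): along every structure-compatible `J : ℤ_p → 𝒪_{ℂ_p}` there is a NONZERO `s ∈ Λ_K⁺ =
ℤ_p⟦T₁⟧` and an exponent `n` with `(ofPlus s)ⁿ · Char(X_Gr)𝒪_{ℂ_p}⟦T₁,T₂⟧ ⊆ (G)`
(`exists_ofPlus_pow_mul_charIdealXGr₂_le_of_thm47AnyRoot_of_cor46`), equivalently a nonzero
cyclotomic-variable series `t ∈ 𝒪_{ℂ_p}⟦T₁⟧` with `t · Char(X_Gr)𝒪_{ℂ_p}⟦T₁,T₂⟧ ⊆ (G)`
(`exists_cyc_mul_charIdealXGr₂_le_of_thm47AnyRoot_of_cor46`) — LITERALLY the conclusion shape of the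
OPEN binder `BurungaleSkinnerTianWan2024.thm924_greenberg_dvd_charIdealXGr₂_awayFromCyc_OPEN` (BSTW24
Thm. 9.24, GMC_r), here obtained at a good ORDINARY prime from two REFEREED Yan–Zhu statements,
Heegner-free. (The remaining printed steps of Thm. 4.2 (2) — removing the primes `P = P⁺Λ_K^ur` by
`μ(𝓛_p^Gr(E/K)⁻) = 0`, [Hsieh14, Thm. B] + Prop. 3.14 — are a commutative-algebra argument in the UFD
`ℤ_p^ur⟦T₁,T₂⟧`; over the receptacle `𝒪_{ℂ_p}⟦T₁,T₂⟧` of (T1) they are NOT replayed here.)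

Ingredients (all tree theorems): `IwasawaAlgebra₂.ofPlus_injective` (`Λ_K⁺ ⊂ Λ_K`),
`BurungaleSkinnerTianWan2024.toUnr₂_ofPlus` (`toUnr₂ J (ofPlus s) = map C (map J s)`),
`exists_structureMap_padicInt`, and the injectivity of a structure-compatible `J` (proved below from
`PadicComplex.norm_extends'`).

## References
* [YanZhu2024MainConjNonCM] J. Algebra 693 (2026) = arXiv:2412.20078v4, proof of Thm. 4.2, first display
  (TeX l.1038–1041), with Thm. 4.7 (l.1022–1034) and Cor. 4.6 (l.996–1003).
* [BurungaleSkinnerTianWan2024] arXiv:2409.01350v2, Thm. 9.24 (GMC_r) — the shape of the conclusion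
  (tree: `thm924_greenberg_dvd_charIdealXGr₂_awayFromCyc_OPEN`).
-/

noncomputable section

open scoped Classical

open PowerSeries NumberField IsDedekindDomain Field CongruenceSubgroup
  Literature.NumberTheory.GaloisRepresentations Literature.NumberTheory.EllipticCurves
  Literature.NumberTheory.EllipticCurves.ModularForms Literature.NumberTheory.EllipticCurves.Rank1Residual

namespace Literature.NumberTheory.EllipticCurves

/-! ## §A. Structure maps are injective; cyclotomic witnesses survive extension of scalars -/

section StructureMap

variable {p : ℕ} [Fact p.Prime]

/-- A ring map `J : ℤ_p → 𝒪_{ℂ_p}` compatible with `ℤ_p ⊂ ℚ_p ⊂ ℂ_p` is injective (the composite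
`ℤ_p → ℂ_p` is an isometry: `PadicComplex.norm_extends'`).
[cite: YanZhu2024MainConjNonCM, §3.4 (Λ_K ⊂ Λ_K^ur = Λ_K ⊗̂ ℤ_p^ur, arXiv:2412.20078v4 TeX l.851)] -/
theorem structureMap_injective {J : ℤ_[p] →+* PadicComplexInt p}
    (hJ : ∀ x : ℤ_[p], ((J x : PadicComplexInt p) : ℂ_[p]) = ((x : ℚ_[p]) : ℂ_[p])) :
    Function.Injective J := by
  refine (injective_iff_map_eq_zero J).mpr fun x hx ↦ ?_
  have h1 : ((x : ℚ_[p]) : ℂ_[p]) = 0 := by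
    rw [← hJ x, hx]
    rfl
  have h2 : ‖(x : ℚ_[p])‖ = 0 := by
    rw [← PadicComplex.norm_extends' p (x : ℚ_[p]), h1, norm_zero]
  have h3 : (x : ℚ_[p]) = 0 := norm_eq_zero.mp h2
  exact PadicInt.coe_eq_zero.mp h3

/-- Hence `PowerSeries.map J` is injective: a NONZERO cyclotomic witness `s ∈ Λ_K⁺ = ℤ_p⟦T₁⟧` stays
nonzero in `𝒪_{ℂ_p}⟦T₁⟧` ("`S` nontrivial"). [cite: YanZhu2024MainConjNonCM, Cor. 4.6 ("a nontrivial multiplicative set S ⊂ Λ_K⁺", arXiv:2412.20078v4 TeX l.996–1000)] -/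
theorem map_structureMap_ne_zero {J : ℤ_[p] →+* PadicComplexInt p}
    (hJ : ∀ x : ℤ_[p], ((J x : PadicComplexInt p) : ℂ_[p]) = ((x : ℚ_[p]) : ℂ_[p]))
    {s : IwasawaAlgebra p} (hs : s ≠ 0) : PowerSeries.map J s ≠ 0 :=
  fun h ↦ hs (PowerSeries.map_injective J (structureMap_injective hJ) (by rw [h, map_zero]))

end StructureMap

end Literature.NumberTheory.EllipticCurves

/-! ## §B. The printed step: Thm. 4.7 + Cor. 4.6 ⟹ `S⁻¹Char(X_Gr)Λ^ur ⊂ (𝓛_p^Gr)`, `S ⊂ Λ_K⁺` -/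

namespace Literature.NumberTheory.EllipticCurves.YanZhu2026

open IwasawaAlgebra₂ UnrSeries₂

variable {p : ℕ} [Fact p.Prime]

/-- **Cor. 4.6's divisibility in the one-generator currency of Thm. 4.7**: the witness `s ∈ Λ_K⁺` of
`IdealLeSpanAwayFromPlus` gives `IdealLeSpanAway (ofPlus s)` with exponent `1`.
[cite: YanZhu2024MainConjNonCM, Cor. 4.6 (arXiv:2412.20078v4 TeX l.996–1003) read in the form of Thm. 4.7 (1) (l.1022–1027)] -/
theorem idealLeSpanAway_ofPlus_of_awayFromPlus {I : Ideal (IwasawaAlgebra₂ p)} {L : CycAntiSeries p}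
    {s : IwasawaAlgebra p}
    (h : ∀ g ∈ I, ∃ h : IwasawaAlgebra₂ p, toCycAnti p (ofPlus p s * g) = L * toCycAnti p h) :
    IdealLeSpanAway (ofPlus p s) I L :=
  ⟨1, fun g hg ↦ by simpa only [pow_one] using h g hg⟩

/-- **Yan–Zhu 2026, proof of Thm. 4.2 (2), first display (v4 l.1038–1041) — PROVED from Thm. 4.7 and
Cor. 4.6:** "there exists a nontrivial multiplicative set `S ⊂ Λ_K⁺ ⊂ Λ_K` such that
`S⁻¹Char_{Λ_K}(𝒳_{𝓕_Gr}(E/K_∞))Λ_K^ur ⊂ (𝓛_p^Gr(E/K))`", in one-generator form: granted the named facts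
`thm47_…AnyRoot…` and `cor46_…`, under `GreenbergSetting` and irreducibility of `ρ̄_E|_{G_K}` (NO
Heegner hypothesis), for EVERY Katz/Greenberg frame `(LK, G)` at `(γ₁⁻¹, γ₂⁻¹)` and every
structure-compatible `J`, some nonzero `s ∈ Λ_K⁺ = ℤ_p⟦T₁⟧` and some `n` satisfy
`(ofPlus s)ⁿ · Char(X_Gr)𝒪_{ℂ_p}⟦T₁,T₂⟧ ⊆ (G)`, `X_Gr = (W.baseChange K).XGr₂ p κ₁ κ₂ 𝔭̄ γ₁ γ₂`. The
embedding `ι₁ : ℤ̄ → ℂ_p` of the type-I frame is any one compatible with `ι` (it only enters through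
Cor. 4.6's frame, which is then eliminated by Thm. 4.7).
[cite: YanZhu2024MainConjNonCM, proof of Thm. 4.2 (2), first display (arXiv:2412.20078v4 TeX l.1038–1041), with Thm. 4.7 (l.1022–1034) and Cor. 4.6 (l.996–1003)] -/
theorem exists_ofPlus_pow_mul_charIdealXGr₂_le_of_thm47AnyRoot_of_cor46
    (h47 : thm47_ord_localised_iff_greenbergAnyRoot_localised)
    (h46 : cor46_XOrd₂_charIdeal_le_perrinRiou_awayFromPlus)
    (ι₁ : integralClosure ℚ ℂ →+* ℂ_[p]) (ι : PadicAlgCl p ≃+* ℂ) (W : WeierstrassCurve ℚ) [W.IsElliptic]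
    [W.IsGloballyMinimal] (K : Type) [Field K] [NumberField K] (v vbar : HeightOneSpectrum (𝓞 K))
    (κ₁ κ₂ : ZpExtension K p) (γ₁ γ₂ : absoluteGaloisGroup K)
    [Fact (ZpExtension.IsTopGeneratorPair κ₁ κ₂ γ₁ γ₂)] {N : ℕ} [NeZero N]
    (π : ModularParametrizationData W N) [NeZero (NumberField.discr K).natAbs]
    (hset : GreenbergSetting ι W N K v vbar κ₁ κ₂) (hirr : (W.baseChange K).HasIrreducibleModPGaloisRep p)
    (hι : ∀ z : integralClosure ℚ ℂ, ι₁ z = ((ι.symm (z : ℂ) : PadicAlgCl p) : ℂ_[p]))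
    {Ω δ : ℂ} {Ωp : (unrIntegers p)ˣ} {LK G : PowerSeries (PowerSeries (PadicComplexInt p))}
    (hLK : IsKatzMeasure₂ ι v vbar ∅ κ₁ κ₂ γ₁⁻¹ γ₂⁻¹ 1 Ω δ ((Ωp : unrIntegers p) : ℂ_[p]) LK)
    (hG : IsGreenbergLFunctionAnyRoot₂ ι v vbar κ₁ κ₂ γ₁⁻¹ γ₂⁻¹ π.f (NumberField.discr K).natAbs
      (NumberField.classNumber K) LK G)
    (J : ℤ_[p] →+* PadicComplexInt p)
    (hJ : ∀ x : ℤ_[p], ((J x : PadicComplexInt p) : ℂ_[p]) = ((x : ℚ_[p]) : ℂ_[p])) :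
    ∃ s : IwasawaAlgebra p, s ≠ 0 ∧ ∃ n : ℕ,
      Ideal.span {toUnr₂ p J (ofPlus p s) ^ n} *
          (WeierstrassCurve.XGr₂.charIdeal (W.baseChange K) p κ₁ κ₂ vbar γ₁ γ₂).map (toUnr₂ p J) ≤
        Ideal.span {G} := by
  -- Cor. 4.6: the type-I frame `F` and the cyclotomic witness `s`
  have hN : (N : ℤ) = W.conductorNorm ℤ := hset.level
  obtain ⟨F, hF, hcF, s, hs, hdiv⟩ := h46 ι₁ W K κ₁ κ₂ γ₁ γ₂ π hset.three_le hset.goodOrd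
    hset.isImaginaryQuadratic hset.split (hN ▸ hset.coprime) hirr hset.cyclotomic hset.anticyclotomic
  -- Thm. 4.7 (1) at `S = {(ofPlus s)ⁿ}` transports it to the Greenberg side
  have hs' : ofPlus p s ≠ 0 := fun h ↦ hs (ofPlus_injective p (by rw [h, map_zero]))
  have h := (h47 ι₁ ι W K v vbar κ₁ κ₂ γ₁ γ₂ π hset hirr hι F hF hcF Ω δ Ωp LK G hLK hG J hJ
    (ofPlus p s) hs').1
  exact ⟨s, hs, h.mp (idealLeSpanAway_ofPlus_of_awayFromPlus hdiv)⟩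

/-- **The same step in the shape of [BSTW24, Thm. 9.24] (GMC_r)** — "after inverting the non-zero
elements of the cyclotomic algebra": a NONZERO cyclotomic-variable series `t ∈ 𝒪_{ℂ_p}⟦T₁⟧` (namely
`t = (J s)ⁿ`, `toUnr₂ J (ofPlus s) = map C (map J s)`) with `t · Char(X_Gr)𝒪_{ℂ_p}⟦T₁,T₂⟧ ⊆ (G)` — i.e.
on the Yan–Zhu locus (good ORDINARY `p > 2` split, `(N, D_K) = 1`, (disc), `ρ̄_E|_{G_K}` irreducible; NO
Heegner, NO square-freeness, NO (spl)) the CONCLUSION of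
`BurungaleSkinnerTianWan2024.thm924_greenberg_dvd_charIdealXGr₂_awayFromCyc_OPEN` follows from the two
refereed Yan–Zhu facts. [cite: YanZhu2024MainConjNonCM, proof of Thm. 4.2 (2), first display (arXiv:2412.20078v4 TeX l.1038–1041)]
[cite: BurungaleSkinnerTianWan2024, Thm. 9.24 (GMC_r), the displayed divisibility (shape only)] -/
theorem exists_cyc_mul_charIdealXGr₂_le_of_thm47AnyRoot_of_cor46
    (h47 : thm47_ord_localised_iff_greenbergAnyRoot_localised)
    (h46 : cor46_XOrd₂_charIdeal_le_perrinRiou_awayFromPlus)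
    (ι₁ : integralClosure ℚ ℂ →+* ℂ_[p]) (ι : PadicAlgCl p ≃+* ℂ) (W : WeierstrassCurve ℚ) [W.IsElliptic]
    [W.IsGloballyMinimal] (K : Type) [Field K] [NumberField K] (v vbar : HeightOneSpectrum (𝓞 K))
    (κ₁ κ₂ : ZpExtension K p) (γ₁ γ₂ : absoluteGaloisGroup K)
    [Fact (ZpExtension.IsTopGeneratorPair κ₁ κ₂ γ₁ γ₂)] {N : ℕ} [NeZero N]
    (π : ModularParametrizationData W N) [NeZero (NumberField.discr K).natAbs]
    (hset : GreenbergSetting ι W N K v vbar κ₁ κ₂) (hirr : (W.baseChange K).HasIrreducibleModPGaloisRep p)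
    (hι : ∀ z : integralClosure ℚ ℂ, ι₁ z = ((ι.symm (z : ℂ) : PadicAlgCl p) : ℂ_[p]))
    {Ω δ : ℂ} {Ωp : (unrIntegers p)ˣ} {LK G : PowerSeries (PowerSeries (PadicComplexInt p))}
    (hLK : IsKatzMeasure₂ ι v vbar ∅ κ₁ κ₂ γ₁⁻¹ γ₂⁻¹ 1 Ω δ ((Ωp : unrIntegers p) : ℂ_[p]) LK)
    (hG : IsGreenbergLFunctionAnyRoot₂ ι v vbar κ₁ κ₂ γ₁⁻¹ γ₂⁻¹ π.f (NumberField.discr K).natAbs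
      (NumberField.classNumber K) LK G)
    (J : ℤ_[p] →+* PadicComplexInt p)
    (hJ : ∀ x : ℤ_[p], ((J x : PadicComplexInt p) : ℂ_[p]) = ((x : ℚ_[p]) : ℂ_[p])) :
    ∃ t : PowerSeries (PadicComplexInt p), t ≠ 0 ∧
      Ideal.span {PowerSeries.map (PowerSeries.C (R := PadicComplexInt p)) t} *
          (WeierstrassCurve.XGr₂.charIdeal (W.baseChange K) p κ₁ κ₂ vbar γ₁ γ₂).map (toUnr₂ p J) ≤
        Ideal.span {G} := by
  obtain ⟨s, hs, n, hle⟩ := exists_ofPlus_pow_mul_charIdealXGr₂_le_of_thm47AnyRoot_of_cor46 h47 h46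
    ι₁ ι W K v vbar κ₁ κ₂ γ₁ γ₂ π hset hirr hι hLK hG J hJ
  refine ⟨PowerSeries.map J s ^ n, pow_ne_zero n (map_structureMap_ne_zero hJ hs), ?_⟩
  rwa [map_pow, ← BurungaleSkinnerTianWan2024.toUnr₂_ofPlus]

/-- **Unconditional-in-`J` form**: a structure-compatible `J : ℤ_p → 𝒪_{ℂ_p}` exists
(`exists_structureMap_padicInt`), so granted the two facts the localised Greenberg divisibility holds
along SOME structure map for every Katz/Greenberg frame.
[cite: YanZhu2024MainConjNonCM, proof of Thm. 4.2 (2), first display (arXiv:2412.20078v4 TeX l.1038–1041)] -/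
theorem exists_structureMap_cyc_mul_charIdealXGr₂_le_of_thm47AnyRoot_of_cor46
    (h47 : thm47_ord_localised_iff_greenbergAnyRoot_localised)
    (h46 : cor46_XOrd₂_charIdeal_le_perrinRiou_awayFromPlus)
    (ι₁ : integralClosure ℚ ℂ →+* ℂ_[p]) (ι : PadicAlgCl p ≃+* ℂ) (W : WeierstrassCurve ℚ) [W.IsElliptic]
    [W.IsGloballyMinimal] (K : Type) [Field K] [NumberField K] (v vbar : HeightOneSpectrum (𝓞 K))
    (κ₁ κ₂ : ZpExtension K p) (γ₁ γ₂ : absoluteGaloisGroup K)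
    [Fact (ZpExtension.IsTopGeneratorPair κ₁ κ₂ γ₁ γ₂)] {N : ℕ} [NeZero N]
    (π : ModularParametrizationData W N) [NeZero (NumberField.discr K).natAbs]
    (hset : GreenbergSetting ι W N K v vbar κ₁ κ₂) (hirr : (W.baseChange K).HasIrreducibleModPGaloisRep p)
    (hι : ∀ z : integralClosure ℚ ℂ, ι₁ z = ((ι.symm (z : ℂ) : PadicAlgCl p) : ℂ_[p]))
    {Ω δ : ℂ} {Ωp : (unrIntegers p)ˣ} {LK G : PowerSeries (PowerSeries (PadicComplexInt p))}
    (hLK : IsKatzMeasure₂ ι v vbar ∅ κ₁ κ₂ γ₁⁻¹ γ₂⁻¹ 1 Ω δ ((Ωp : unrIntegers p) : ℂ_[p]) LK)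
    (hG : IsGreenbergLFunctionAnyRoot₂ ι v vbar κ₁ κ₂ γ₁⁻¹ γ₂⁻¹ π.f (NumberField.discr K).natAbs
      (NumberField.classNumber K) LK G) :
    ∃ J : ℤ_[p] →+* PadicComplexInt p,
      (∀ x : ℤ_[p], ((J x : PadicComplexInt p) : ℂ_[p]) = ((x : ℚ_[p]) : ℂ_[p])) ∧
      ∃ t : PowerSeries (PadicComplexInt p), t ≠ 0 ∧
        Ideal.span {PowerSeries.map (PowerSeries.C (R := PadicComplexInt p)) t} *
            (WeierstrassCurve.XGr₂.charIdeal (W.baseChange K) p κ₁ κ₂ vbar γ₁ γ₂).map (toUnr₂ p J) ≤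
          Ideal.span {G} := by
  obtain ⟨J, hJ⟩ := exists_structureMap_padicInt (p := p)
  exact ⟨J, hJ, exists_cyc_mul_charIdealXGr₂_le_of_thm47AnyRoot_of_cor46 h47 h46 ι₁ ι W K v vbar κ₁ κ₂
    γ₁ γ₂ π hset hirr hι hLK hG J hJ⟩

end Literature.NumberTheory.EllipticCurves.YanZhu2026

end
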